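import Mathlib.Analysis.SpecialFunctions.ExpDeriv
import Mathlib.Analysis.InnerProductSpace.Adjoint
import Mathlib.Analysis.InnerProductSpace.Calculus
import Mathlib.Tactic.Module
import Mathlib.Tactic.LinearCombination
import Literature.Analysis.FluidPDE.KelvinModeLinearFlow
import HarnessLib

/-!
# Three real exponential Kelvin modes on a linear flow — part 1: the exponential wave, the triad
# flow, its pressure, and the spatial calculus of a slice (negative-side tool for crux
# `PoloidalWindowRigidity`, K2, 19708; the solution theorem is in `ExpTriadLinearFlow.lean`)

Theorems/…/Negative proofs file (theorems + data definitions, no `Prop` facts).  This is the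
real-exponential ("suction layer") twin of `Literature/Analysis/FluidPDE/KelvinModeLinearFlow.lean`
(Craik–Criminale 1986: one Kelvin mode on a linear flow is an exact solution), extended to THREE
modes whose pairwise advection terms are gradients.

## What is here (general finite-dimensional real inner-product space `E`)
* `ewave k a x = exp⟪k, x⟫ a`, its derivative, divergence `exp⟪k,x⟫ ⟪k, a⟫` and Laplacian
  `Δ ewave = ‖k‖² ewave`.
* `expAmplitudeRHS ν A k a = −A a + (2⟪k, A a⟫/‖k‖²) k + ν‖k‖² a` — the amplitude equation of a
  real exponential mode (the viscous term has the sign `+ν‖k‖²`: `Δ e^{⟪k,x⟫} = +‖k‖² e^{⟪k,x⟫}`).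
* `triad A k a t x = A x + Σ_{j<3} exp⟪k_j(t), x⟫ a_j(t)` and its explicit pressure `triadPressure`
  (base pressure `−½⟪x, A²x⟫`, the three projection terms, and three PAIR terms
  `−c_{ij}(t) e^{⟪k_i + k_j, x⟫}`).
* the slice calculus: `hasFDerivAt_slice`, `convect_slice`, `laplacian_slice`, the pressure
  gradient, `fderiv_triad_apply`, `contDiff_triad` (used by `ExpTriadLinearFlow.lean` for the
  momentum equation and by `StrainedCrossedLayers*.lean` for the vorticity of the instance).

## What this is for
The instance `StrainedCrossedLayers.lean` (same directory): three such layers on the axisymmetric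
strain `diag(−γ/2, −γ/2, γ)` form an exact unsteady POLOIDAL flow whose Clebsch slope is spatially
constant but time-dependent and whose vorticity has no Killing symmetry — the (TV) stratum of the
line `lrc-jet` of crux K2 is non-empty among local analytic NS germs.  Spatially unbounded,
infinite-energy solutions.  WHAT THIS IS NOT: not a statement about Navier–Stokes regularity or
blow-up; nothing here is in the route's class `𝔓(C)`; no registered item is refuted by this file.

References: Craik–Criminale 1986 and Drazin 2002, Ex. 2.19 / 8.27 as cited in
`KelvinModeLinearFlow.lean` (mechanism only; every statement below is proved).
-/

noncomputable section

open Set Function Filter InnerProductSpace WithLp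
open scoped ContDiff Laplacian InnerProductSpace RealInnerProductSpace InnerProduct Topology

-- the summit and its single sub-problem share the name (CONVENTIONS §1)
set_option linter.dupNamespace false

namespace Summit.NavierStokesRegularity.NavierStokesRegularity.Theorems.PoloidalWindowRigidity.Negative.ExpTriad

open Literature.Analysis.FluidPDE Literature.Analysis.FluidPDE.KelvinMode

variable {E : Type*} [NormedAddCommGroup E] [InnerProductSpace ℝ E] [FiniteDimensional ℝ E]

/-! ### §1 The real exponential wave and its spatial calculus -/

/-- The real exponential wave (suction layer) with wavevector `k` and amplitude `a`:
`w(x) = e^{⟪k, x⟫} a`. [folklore] -/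
def ewave (k a : E) (x : E) : E :=
  Real.exp ⟪k, x⟫ • a

omit [FiniteDimensional ℝ E] in
/-- Unfolding the exponential wave. [folklore] -/
theorem ewave_apply (k a x : E) : ewave k a x = Real.exp ⟪k, x⟫ • a := rfl

omit [FiniteDimensional ℝ E] in
/-- `D(e^{⟪k,·⟫})(x) = e^{⟪k,x⟫} ⟪k, ·⟫`. [folklore] -/
private theorem hasFDerivAt_exp_inner (k x : E) :
    HasFDerivAt (fun y : E => Real.exp ⟪k, y⟫) ((Real.exp ⟪k, x⟫) • (innerSL ℝ k : E →L[ℝ] ℝ)) x :=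
  (Real.hasDerivAt_exp _).comp_hasFDerivAt x (innerSL ℝ k : E →L[ℝ] ℝ).hasFDerivAt

/-- The derivative of the exponential wave at `x`: `h ↦ (e^{⟪k,x⟫} ⟪k, h⟫) a`. [folklore] -/
def ewaveDeriv (k a x : E) : E →L[ℝ] E :=
  ((Real.exp ⟪k, x⟫) • (innerSL ℝ k : E →L[ℝ] ℝ)).smulRight a

omit [FiniteDimensional ℝ E] in
/-- The derivative of the exponential wave applied to a vector. [folklore] -/
@[simp] theorem ewaveDeriv_apply (k a x h : E) :
    ewaveDeriv k a x h = (Real.exp ⟪k, x⟫ * ⟪k, h⟫) • a := by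
  simp [ewaveDeriv, smul_eq_mul]

omit [FiniteDimensional ℝ E] in
/-- The exponential wave is differentiable with derivative `ewaveDeriv`. [folklore] -/
theorem hasFDerivAt_ewave (k a x : E) : HasFDerivAt (ewave k a) (ewaveDeriv k a x) x :=
  (hasFDerivAt_exp_inner k x).smul_const a

omit [FiniteDimensional ℝ E] in
/-- The exponential wave is smooth. [folklore] -/
theorem contDiff_ewave (k a : E) {n : WithTop ℕ∞} : ContDiff ℝ n (ewave k a) :=
  (Real.contDiff_exp.comp (innerSL ℝ k : E →L[ℝ] ℝ).contDiff).smul contDiff_const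

/-- **Divergence of the exponential wave**: `div w (x) = e^{⟪k,x⟫} ⟪k, a⟫` (zero for `k ⊥ a`). [folklore] -/
theorem divergence_ewave (k a x : E) :
    VectorCalculus.divergence (ewave k a) x = Real.exp ⟪k, x⟫ * ⟪k, a⟫ := by
  set B := stdOrthonormalBasis ℝ E
  rw [divergence_eq_sum_inner_fderiv B, (hasFDerivAt_ewave k a x).fderiv]
  simp only [ewaveDeriv_apply, real_inner_smul_right]
  rw [← B.sum_inner_mul_inner k a, Finset.mul_sum]
  exact Finset.sum_congr rfl fun i _ => by ring

/-- `Δ(φ c) = (Δφ) c` for a constant vector `c`. [folklore] -/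
private theorem laplacian_smul_const_eq {F : Type*} [NormedAddCommGroup F] [NormedSpace ℝ F]
    {φ : E → ℝ} (hφ : ContDiff ℝ 2 φ) (c : F) (x : E) :
    Δ (fun y => φ y • c) x = (Δ φ x) • c := by
  have h : (fun y => φ y • c) = ⇑((ContinuousLinearMap.id ℝ ℝ).smulRight c) ∘ φ := by
    funext y; simp
  rw [h, hφ.contDiffAt.laplacian_CLM_comp_left]
  simp

/-- The Laplacian of a continuous linear map vanishes. [folklore] -/
private theorem laplacian_clm_eq_zero (L : E →L[ℝ] E) (x : E) : Δ (fun y => L y) x = 0 := by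
  rw [laplacian_eq_sum_fderiv_fderiv (stdOrthonormalBasis ℝ E) L.contDiff x]
  refine Finset.sum_eq_zero fun i _ => ?_
  have h : (fun y => fderiv ℝ (fun y => L y) y (stdOrthonormalBasis ℝ E i)) =
      fun _ => L (stdOrthonormalBasis ℝ E i) := by
    funext y; rw [L.fderiv]
  rw [h]
  simp

/-- **`Δ w = ‖k‖² w`**: the exponential wave is an eigenfunction of the Laplacian with POSITIVE
eigenvalue. [folklore] -/
theorem laplacian_ewave (k a x : E) : Δ (ewave k a) x = (‖k‖ ^ 2) • ewave k a x := by
  have he2 : ContDiff ℝ 2 (fun y : E => Real.exp ⟪k, y⟫) :=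
    Real.contDiff_exp.comp (innerSL ℝ k : E →L[ℝ] ℝ).contDiff
  have hΔ : Δ (fun y : E => Real.exp ⟪k, y⟫) x = Real.exp ⟪k, x⟫ * ‖k‖ ^ 2 :=
    Literature.Analysis.PDE.LoewnerNirenberg.laplacian_comp_inner (g := Real.exp)
      (g₁ := Real.exp) isOpen_univ (fun σ _ => Real.hasDerivAt_exp σ) k (mem_univ _)
      (Real.hasDerivAt_exp _)
  have h : ewave k a = fun y => Real.exp ⟪k, y⟫ • a := rfl
  rw [h, laplacian_smul_const_eq he2 a x, hΔ, mul_comm, mul_smul]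

/-! ### §2 The amplitude equation, the triad flow and its pressure -/

/-- The amplitude equation of a REAL EXPONENTIAL Kelvin mode with viscosity:
`ȧ = −A a + (2⟪k, A a⟫/‖k‖²) k + ν‖k‖² a` (projection term = Lagrange multiplier keeping `a ⊥ k`;
the viscous term enters with `+` because `Δ e^{⟪k,x⟫} = +‖k‖² e^{⟪k,x⟫}`). [folklore] -/
def expAmplitudeRHS (ν : ℝ) (A : E →L[ℝ] E) (k a : E) : E :=
  -(A a) + (2 * ⟪k, A a⟫ / ‖k‖ ^ 2) • k + (ν * ‖k‖ ^ 2) • a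

/-- **The triad flow**: linear base flow plus three real exponential modes,
`u(t, x) = A x + Σ_{j<3} e^{⟪k_j(t), x⟫} a_j(t)`. [folklore] -/
def triad (A : E →L[ℝ] E) (k a : Fin 3 → ℝ → E) (t : ℝ) (x : E) : E :=
  A x + (ewave (k 0 t) (a 0 t) x + ewave (k 1 t) (a 1 t) x + ewave (k 2 t) (a 2 t) x)

/-- **The pressure of the triad flow**: base pressure `−½⟪x, A²x⟫`, the three projection terms
`pressureCoeff A k_j a_j · e^{⟪k_j, x⟫}`, and the three pair terms `−c_{ij} e^{⟪k_i,x⟫} e^{⟪k_j,x⟫}`. [folklore] -/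
def triadPressure (A : E →L[ℝ] E) (k a : Fin 3 → ℝ → E) (c : Fin 3 → Fin 3 → ℝ → ℝ) (t : ℝ)
    (x : E) : ℝ :=
  basePressure A x +
    (pressureCoeff A (k 0 t) (a 0 t) * Real.exp ⟪k 0 t, x⟫ +
      pressureCoeff A (k 1 t) (a 1 t) * Real.exp ⟪k 1 t, x⟫ +
      pressureCoeff A (k 2 t) (a 2 t) * Real.exp ⟪k 2 t, x⟫) -
    (c 0 1 t * (Real.exp ⟪k 0 t, x⟫ * Real.exp ⟪k 1 t, x⟫) +
      c 0 2 t * (Real.exp ⟪k 0 t, x⟫ * Real.exp ⟪k 2 t, x⟫) +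
      c 1 2 t * (Real.exp ⟪k 1 t, x⟫ * Real.exp ⟪k 2 t, x⟫))

/-! ### §3 Space derivatives of a time slice -/

section Slice

variable (A : E →L[ℝ] E) (k₀ k₁ k₂ a₀ a₁ a₂ : E)

omit [FiniteDimensional ℝ E] in
/-- Derivative of a slice `y ↦ A y + Σ_j w_j(y)`. [folklore] -/
theorem hasFDerivAt_slice (x : E) :
    HasFDerivAt (fun y => A y + (ewave k₀ a₀ y + ewave k₁ a₁ y + ewave k₂ a₂ y))
      (A + (ewaveDeriv k₀ a₀ x + ewaveDeriv k₁ a₁ x + ewaveDeriv k₂ a₂ x)) x :=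
  A.hasFDerivAt.add (((hasFDerivAt_ewave k₀ a₀ x).add (hasFDerivAt_ewave k₁ a₁ x)).add
    (hasFDerivAt_ewave k₂ a₂ x))

omit [FiniteDimensional ℝ E] in
/-- **Self-advection of a slice** `u = A· + Σ_j e^{⟪k_j,·⟫} a_j`:
`(u·∇)u = A²x + Σ_i e_i A a_i + Σ_j e_j (⟪k_j, A x⟫ + Σ_i e_i ⟪k_j, a_i⟫) a_j`. [folklore] -/
theorem convect_slice (x : E) :
    convect (fun y => A y + (ewave k₀ a₀ y + ewave k₁ a₁ y + ewave k₂ a₂ y))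
        (fun y => A y + (ewave k₀ a₀ y + ewave k₁ a₁ y + ewave k₂ a₂ y)) x =
      A (A x) + (Real.exp ⟪k₀, x⟫ • A a₀ + Real.exp ⟪k₁, x⟫ • A a₁ + Real.exp ⟪k₂, x⟫ • A a₂) +
        ((Real.exp ⟪k₀, x⟫ * (⟪k₀, A x⟫ + (Real.exp ⟪k₀, x⟫ * ⟪k₀, a₀⟫ +
            Real.exp ⟪k₁, x⟫ * ⟪k₀, a₁⟫ + Real.exp ⟪k₂, x⟫ * ⟪k₀, a₂⟫))) • a₀ +
          (Real.exp ⟪k₁, x⟫ * (⟪k₁, A x⟫ + (Real.exp ⟪k₀, x⟫ * ⟪k₁, a₀⟫ +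
            Real.exp ⟪k₁, x⟫ * ⟪k₁, a₁⟫ + Real.exp ⟪k₂, x⟫ * ⟪k₁, a₂⟫))) • a₁ +
          (Real.exp ⟪k₂, x⟫ * (⟪k₂, A x⟫ + (Real.exp ⟪k₀, x⟫ * ⟪k₂, a₀⟫ +
            Real.exp ⟪k₁, x⟫ * ⟪k₂, a₁⟫ + Real.exp ⟪k₂, x⟫ * ⟪k₂, a₂⟫))) • a₂) := by
  rw [convect_apply, (hasFDerivAt_slice A k₀ k₁ k₂ a₀ a₁ a₂ x).fderiv]
  simp only [_root_.add_apply, ewaveDeriv_apply, map_add, map_smul, ewave]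
  module

/-- **Laplacian of a slice**: `Δ(A· + Σ_j w_j) = Σ_j ‖k_j‖² w_j`. [folklore] -/
theorem laplacian_slice (x : E) :
    Δ (fun y => A y + (ewave k₀ a₀ y + ewave k₁ a₁ y + ewave k₂ a₂ y)) x =
      (‖k₀‖ ^ 2) • ewave k₀ a₀ x + (‖k₁‖ ^ 2) • ewave k₁ a₁ x + (‖k₂‖ ^ 2) • ewave k₂ a₂ x := by
  have hA : ContDiffAt ℝ 2 (fun y => A y) x := A.contDiff.contDiffAt
  have h0 : ContDiffAt ℝ 2 (ewave k₀ a₀) x := (contDiff_ewave k₀ a₀).contDiffAt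
  have h1 : ContDiffAt ℝ 2 (ewave k₁ a₁) x := (contDiff_ewave k₁ a₁).contDiffAt
  have h2 : ContDiffAt ℝ 2 (ewave k₂ a₂) x := (contDiff_ewave k₂ a₂).contDiffAt
  have h01 : ContDiffAt ℝ 2 (ewave k₀ a₀ + ewave k₁ a₁) x := h0.add h1
  have h012 : ContDiffAt ℝ 2 (ewave k₀ a₀ + ewave k₁ a₁ + ewave k₂ a₂) x := h01.add h2
  have hsplit : (fun y => A y + (ewave k₀ a₀ y + ewave k₁ a₁ y + ewave k₂ a₂ y)) =
      (fun y => A y) + (ewave k₀ a₀ + ewave k₁ a₁ + ewave k₂ a₂) := rfl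
  rw [hsplit, hA.laplacian_add h012, h01.laplacian_add h2, h0.laplacian_add h1,
    laplacian_clm_eq_zero, laplacian_ewave, laplacian_ewave, laplacian_ewave, zero_add]

/-- Divergence of a slice: `div(A· + Σ_j w_j) = div(A·) + Σ_j e_j ⟪k_j, a_j⟫`. [folklore] -/
theorem divergence_slice (x : E) :
    VectorCalculus.divergence (fun y => A y + (ewave k₀ a₀ y + ewave k₁ a₁ y + ewave k₂ a₂ y)) x =
      VectorCalculus.divergence (fun y => A y) x +
        (Real.exp ⟪k₀, x⟫ * ⟪k₀, a₀⟫ + Real.exp ⟪k₁, x⟫ * ⟪k₁, a₁⟫ + Real.exp ⟪k₂, x⟫ * ⟪k₂, a₂⟫) := by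
  have d0 : DifferentiableAt ℝ (ewave k₀ a₀) x := (hasFDerivAt_ewave k₀ a₀ x).differentiableAt
  have d1 : DifferentiableAt ℝ (ewave k₁ a₁) x := (hasFDerivAt_ewave k₁ a₁ x).differentiableAt
  have d2 : DifferentiableAt ℝ (ewave k₂ a₂) x := (hasFDerivAt_ewave k₂ a₂ x).differentiableAt
  have d01 : DifferentiableAt ℝ (fun y => ewave k₀ a₀ y + ewave k₁ a₁ y) x := d0.add d1
  have d012 : DifferentiableAt ℝ (fun y => ewave k₀ a₀ y + ewave k₁ a₁ y + ewave k₂ a₂ y) x :=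
    d01.add d2
  have dA : DifferentiableAt ℝ (fun y => A y) x := (A.hasFDerivAt (x := x)).differentiableAt
  rw [divergence_add_apply (v := fun y => A y)
      (w := fun y => ewave k₀ a₀ y + ewave k₁ a₁ y + ewave k₂ a₂ y) dA d012,
    divergence_add_apply (v := fun y => ewave k₀ a₀ y + ewave k₁ a₁ y) (w := ewave k₂ a₂) d01 d2,
    divergence_add_apply (v := ewave k₀ a₀) (w := ewave k₁ a₁) d0 d1, divergence_ewave,
    divergence_ewave, divergence_ewave]

/-- `∇(π e^{⟪k,·⟫})(x) = (π e^{⟪k,x⟫}) k`. [folklore] -/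
private theorem hasGradientAt_mul_exp_inner (π : ℝ) (k x : E) :
    HasGradientAt (fun y : E => π * Real.exp ⟪k, y⟫) ((π * Real.exp ⟪k, x⟫) • k) x := by
  rw [hasGradientAt_iff_hasFDerivAt]
  refine ((hasFDerivAt_exp_inner k x).const_mul π).congr_fderiv ?_
  ext v
  simp only [_root_.smul_apply, innerSL_apply_apply, smul_eq_mul,
    InnerProductSpace.toDual_apply_apply, real_inner_smul_left]
  ring

/-- `∇(c e^{⟪k,·⟫} e^{⟪l,·⟫})(x) = (c e^{⟪k,x⟫} e^{⟪l,x⟫}) (k + l)`. [folklore] -/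
private theorem hasGradientAt_mul_exp_exp (c : ℝ) (k l x : E) :
    HasGradientAt (fun y : E => c * (Real.exp ⟪k, y⟫ * Real.exp ⟪l, y⟫))
      ((c * (Real.exp ⟪k, x⟫ * Real.exp ⟪l, x⟫)) • (k + l)) x := by
  rw [hasGradientAt_iff_hasFDerivAt]
  refine (((hasFDerivAt_exp_inner k x).mul (hasFDerivAt_exp_inner l x)).const_mul c).congr_fderiv ?_
  ext v
  simp only [_root_.smul_apply, _root_.add_apply, innerSL_apply_apply, smul_eq_mul,
    InnerProductSpace.toDual_apply_apply, real_inner_smul_left, inner_add_left]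
  ring

/-- **Gradient of a pressure slice**:
`∇(−½⟪x,A²x⟫ + Σ_j π_j e^{⟪k_j,x⟫} − Σ_{i<j} c_{ij} e^{⟪k_i,x⟫}e^{⟪k_j,x⟫})
 = −A²x + Σ_j (π_j e_j) k_j − Σ_{i<j} (c_{ij} e_i e_j)(k_i + k_j)`. [folklore] -/
theorem gradient_pressureSlice (hA2 : ∀ x y : E, ⟪A (A x), y⟫ = ⟪x, A (A y)⟫)
    (π₀ π₁ π₂ c₀₁ c₀₂ c₁₂ : ℝ) (x : E) :
    gradient (fun y => basePressure A y +
        (π₀ * Real.exp ⟪k₀, y⟫ + π₁ * Real.exp ⟪k₁, y⟫ + π₂ * Real.exp ⟪k₂, y⟫) -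
        (c₀₁ * (Real.exp ⟪k₀, y⟫ * Real.exp ⟪k₁, y⟫) + c₀₂ * (Real.exp ⟪k₀, y⟫ * Real.exp ⟪k₂, y⟫) +
          c₁₂ * (Real.exp ⟪k₁, y⟫ * Real.exp ⟪k₂, y⟫))) x =
      -(A (A x)) +
        ((π₀ * Real.exp ⟪k₀, x⟫) • k₀ + (π₁ * Real.exp ⟪k₁, x⟫) • k₁ + (π₂ * Real.exp ⟪k₂, x⟫) • k₂) -
        ((c₀₁ * (Real.exp ⟪k₀, x⟫ * Real.exp ⟪k₁, x⟫)) • (k₀ + k₁) +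
          (c₀₂ * (Real.exp ⟪k₀, x⟫ * Real.exp ⟪k₂, x⟫)) • (k₀ + k₂) +
          (c₁₂ * (Real.exp ⟪k₁, x⟫ * Real.exp ⟪k₂, x⟫)) • (k₁ + k₂)) := by
  have hb := hasGradientAt_iff_hasFDerivAt.mp (hasGradientAt_basePressure A hA2 x)
  have g0 := hasGradientAt_iff_hasFDerivAt.mp (hasGradientAt_mul_exp_inner π₀ k₀ x)
  have g1 := hasGradientAt_iff_hasFDerivAt.mp (hasGradientAt_mul_exp_inner π₁ k₁ x)
  have g2 := hasGradientAt_iff_hasFDerivAt.mp (hasGradientAt_mul_exp_inner π₂ k₂ x)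
  have p01 := hasGradientAt_iff_hasFDerivAt.mp (hasGradientAt_mul_exp_exp c₀₁ k₀ k₁ x)
  have p02 := hasGradientAt_iff_hasFDerivAt.mp (hasGradientAt_mul_exp_exp c₀₂ k₀ k₂ x)
  have p12 := hasGradientAt_iff_hasFDerivAt.mp (hasGradientAt_mul_exp_exp c₁₂ k₁ k₂ x)
  have h : HasGradientAt (fun y => basePressure A y +
        (π₀ * Real.exp ⟪k₀, y⟫ + π₁ * Real.exp ⟪k₁, y⟫ + π₂ * Real.exp ⟪k₂, y⟫) -
        (c₀₁ * (Real.exp ⟪k₀, y⟫ * Real.exp ⟪k₁, y⟫) + c₀₂ * (Real.exp ⟪k₀, y⟫ * Real.exp ⟪k₂, y⟫) +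
          c₁₂ * (Real.exp ⟪k₁, y⟫ * Real.exp ⟪k₂, y⟫)))
      (-(A (A x)) +
        ((π₀ * Real.exp ⟪k₀, x⟫) • k₀ + (π₁ * Real.exp ⟪k₁, x⟫) • k₁ + (π₂ * Real.exp ⟪k₂, x⟫) • k₂) -
        ((c₀₁ * (Real.exp ⟪k₀, x⟫ * Real.exp ⟪k₁, x⟫)) • (k₀ + k₁) +
          (c₀₂ * (Real.exp ⟪k₀, x⟫ * Real.exp ⟪k₂, x⟫)) • (k₀ + k₂) +
          (c₁₂ * (Real.exp ⟪k₁, x⟫ * Real.exp ⟪k₂, x⟫)) • (k₁ + k₂))) x := by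
    rw [hasGradientAt_iff_hasFDerivAt]
    simp only [map_add, map_sub]
    exact (hb.add ((g0.add g1).add g2)).sub ((p01.add p02).add p12)
  exact h.gradient

end Slice

omit [FiniteDimensional ℝ E] in
/-- **The space derivative of a slice of the triad flow**:
`D(u(t))(x)[h] = A h + Σ_j (e^{⟪k_j(t), x⟫} ⟪k_j(t), h⟫) a_j(t)`. [folklore] -/
theorem fderiv_triad_apply (A : E →L[ℝ] E) (k a : Fin 3 → ℝ → E) (t : ℝ) (x h : E) :
    fderiv ℝ (triad A k a t) x h = A h +
      ((Real.exp ⟪k 0 t, x⟫ * ⟪k 0 t, h⟫) • a 0 t + (Real.exp ⟪k 1 t, x⟫ * ⟪k 1 t, h⟫) • a 1 t +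
        (Real.exp ⟪k 2 t, x⟫ * ⟪k 2 t, h⟫) • a 2 t) := by
  have hflow : triad A k a t =
      fun y => A y + (ewave (k 0 t) (a 0 t) y + ewave (k 1 t) (a 1 t) y + ewave (k 2 t) (a 2 t) y) :=
    rfl
  rw [hflow, (hasFDerivAt_slice A (k 0 t) (k 1 t) (k 2 t) (a 0 t) (a 1 t) (a 2 t) x).fderiv]
  simp only [_root_.add_apply, ewaveDeriv_apply]

omit [FiniteDimensional ℝ E] in
/-- Slices of the triad flow are smooth. [folklore] -/
theorem contDiff_triad (A : E →L[ℝ] E) (k a : Fin 3 → ℝ → E) (t : ℝ) {n : WithTop ℕ∞} :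
    ContDiff ℝ n (triad A k a t) :=
  A.contDiff.add (((contDiff_ewave _ _).add (contDiff_ewave _ _)).add (contDiff_ewave _ _))

end Summit.NavierStokesRegularity.NavierStokesRegularity.Theorems.PoloidalWindowRigidity.Negative.ExpTriad
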